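import Summits.QuantumFields.YangMills.Theorems.UnitScaleTiltProp7LocalProjectorRowCube
import Summits.QuantumFields.YangMills.Theorems.UnitScaleTiltProp7LODSlotK2WindowLetters
import HarnessLib

/-!
# Route `UnitScaleTilt`, crux K1 «MinimiserStabilityRegPr» (stmt-QuantumFields-19200), EX row `hGF[Lift]` (curved member) — **LOD LINE, (L6) ROW `hloc` PER CUBE: THE WINDOW LETTERS OF
# routeR-w2 g13's ✓`Prop7LocalProjectorRowCube.hloc_of_cube_rows` (p760402) DISCHARGED K-UNIFORMLY** — its Combes–Thomas slopes `0 < μ′ < μ`, `δ₁`, `δ₁′` and the rows `hδ`, `hwin` (window at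
# `μ`), `hδV`, `hwinV`, `hgapV` (window + gap at `μ′`) are the SAME B-series letters as (K2b)'s, so the closed choices of ✓`Prop7LODSlotK2MemberWindow.hKP_pin` (p760541) —
# `μ(am) := 1∕(10·√(max 2 (16∕am))·√(27 + (2025∕8)am))`, `μ′(am) := min (μ∕2) (m_B∕(3Γ(am)))`, `δ₁ := √(27 + (2025∕8)am)·μ`, `δ₁′ := √(…)·μ′` — discharge them for every
# `η = L^{−(K−n)} ∈ (0,1]` at the chair's pin-(2) coarse weight `c₁ := c₀·(L³)^{K−n}` (✓`Prop7LODSlotK2WindowLetters`, p760318), and the printed `δP` is bounded by a CLOSED TERM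
# `δPmax(am, cG, cQ, εN, r)` of the massive mass, px5 g11's three row constants and the near radius ONLY (no `K`, `n`, `L^{K−n}`, `|T³|`).  This is px10 g11's displayed `hloc` of
# ✓`Prop7LODAssemblyMember.curvedTarget_member_of_hKP_hloc` (p759770) with NO B-series letter left, for w2 g12's `budget_theta` (`δP ≤ g∕(64(c₆+1))`).

Cell `ym3-torus` (HUMAN RULING D-0037, YM ladder rung R3 — NOT d = 4, NOT infinite volume, NOT a mass gap, NOT Clay).  Width seat `ym-routeR-w4` gen 27 («MINE δP-letters» 2026-08-30 04:20:36Z,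
px10 g11 04:17:14Z «WHO? say MINE δP-letters»).  THEOREMS ONLY (0 `def`, 0 `sorry`); `--supports stmt-QuantumFields-19200 --as helper`, count-neutral.  HONEST LABEL (★★OWNER RULING №33 (6)):
curved γ-row supplier line, (L6) assembly letters; REAL ARITHMETIC + a knit of landed rows; what stays DISPLAYED is exactly routeR-w2's non-numeric input: the per-cube massive data
`Qc Tc Gc` ∕ flat `Q1 T1 G1` (data of record), the coarse reading `ι` at the pin, px5 g11's three rows per cube (`hop`, `hRB1`, `hRB2` with constants `εN, cG, cQ`) and the near radius `r`.
HONEST SIZE: `δPmax` carries `m_B⁻² ≈ 1.4·10¹⁶`, `m_B⁻⁴`, and the tail `C·e^{−μ′(am)·r∕2}` with `μ′(1) ≈ 1.4·10⁻¹⁶` and `C ~ 10^{90}`-class — so the window asks `cG, cQ, εN`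
astronomically small (they are `ε₀`-controlled rows: the cap `αLOD` pays) and `r ≳ 10¹⁸` coarse units (free on the COVER road, chair WORD №1 (A)); nothing of px5's rows, the window
`γ > 0`, `hT`, `hGF`, EX ∕ 19200 is proved here.

WHAT IS PROVED (ns `Summit.QuantumFields.YangMills.Theorems.Prop7LocalProjectorRowCubeWindow`).
* §1 `window_win_le` (`hwinV` from `hwin`'s equality and `μ′ ≤ μ`) · ★★ `deltaP_le` (ATOM form: ✓p760402's printed `δP` `≤ δPmax(a, μ, μ′, ν̄, cG, cQ, εN, r)` given `10μ ≤ 1`, `μ′ ≤ μ∕2`,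
  `1∕μ′ ≤ ν̄`, the gap letters `(m_B²∕2 − 3GAP²)⁻¹ ≤ 6∕m_B²`, `0 < m_B²∕2 − 3GAP²`).
* §3 (v1.1) `budget_of_quarters` (abstract) · ★★ `deltaPmax_le_of_budget` (`δPmax ≤ t` from four quarter-budgets on `cG, cQ, εN, r` with CLOSED `A(a), B(a), D(a), r₀(a,t)`).
* §2 ★★★ `hloc_pin` — ✓`hloc_of_cube_rows` at `c₁ = c₀(L³)^{K−n}` (hypothesis `hc₁`), slopes∕δ's := the closed choices, **`hδ hwin hδV hwinV hgapV` DISCHARGED**, conclusion = px10's `hloc`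
  binder shape with `δP := δPmax(am, cG, cQ, εN, r)`.

References: T. Bałaban, CMP **99** (1985) 389–434 [Balaban1985BackgroundPropagators] ((3.20)–(3.26) pp.394–395, Thm 3.1 (3.46) p.398, (3.49) p.399, (3.105)–(3.106) p.414);
CMP **119** (1988) 243–285 [Balaban1988RG2Cluster] ((2.7) p.13).
-/

set_option autoImplicit false

noncomputable section

open scoped BigOperators Matrix.Norms.L2Operator InnerProductSpace ComplexConjugate Matrix

namespace Summit.QuantumFields.YangMills.Theorems.Prop7LocalProjectorRowCubeWindow

open Literature.MathematicalPhysics.QuantumFieldTheory.Balaban1983to89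
open T4Continuum BlockAveraging
open BlockAveraging (Idx)
open B7Prop1Explicit (U1 disp)
open B5Eq118OneStroke (iterBlockOf iterBlock)
open B10Eq27TorusAxialLog (holT transl axialT)
open B7TransferAnalyticMean (meanCLM)
open B11Eq103H1Complex (SiteL2K BondL2K projR)
open Summit.QuantumFields.YangMills.Theorems.Prop8Chart (emlIterU)
open Literature.MathematicalPhysics.QuantumFieldTheory.Balaban1983to89.T3ContinuumYM3Torus
open T3SectALandauChart (eta eta_pos bgUnits)
open T3PrintedRegularMinimiser (RegPr)
open T3PrintedRegularOrbits (sites_eq)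
open T3LevelShift (siteShift)
open Summit.QuantumFields.YangMills.Theorems.Prop7SectET3Transport (periodsT3)
open Summit.QuantumFields.YangMills.Theorems.Prop7SectET3HilbertLetters (W₂ toL2 toL2S DstarL2 covLapSite)
open Summit.QuantumFields.YangMills.Theorems.Prop7LocalProjectorRowCube (hloc_of_cube_rows)
open Summit.QuantumFields.YangMills.Theorems.Prop7LODSlotK2WindowLetters

/-! ## §1 Real letters: `hwinV` by monotonicity, and the K-free bound of the printed `δP` -/

section Real

/-- `hwinV` FROM `hwin`: the window row at the smaller slope, `√M·(√(27 + (2025∕8)a)·μ′) ≤ 1∕10` for `μ′ ≤ μ(a)` (equality at `μ`, ✓`window_win`).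
[cite: Balaban1985BackgroundPropagators, (3.46) p.398] -/
theorem window_win_le {a : ℝ} (ha : 0 < a) {M : ℝ} (hM : M = max 2 (16 / a)) {μ' : ℝ}
    (hμ' : μ' ≤ 1 / (10 * Real.sqrt (max 2 (16 / a)) * Real.sqrt (27 + 2025 / 8 * a))) :
    Real.sqrt M * (Real.sqrt (27 + 2025 / 8 * a) * μ') ≤ 1 / 10 := by
  have h := window_win ha hM
  have hsM : 0 ≤ Real.sqrt M := Real.sqrt_nonneg _
  have hsc : 0 ≤ Real.sqrt (27 + 2025 / 8 * a) := Real.sqrt_nonneg _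
  calc Real.sqrt M * (Real.sqrt (27 + 2025 / 8 * a) * μ')
      ≤ Real.sqrt M * (Real.sqrt (27 + 2025 / 8 * a) * (1 / (10 * Real.sqrt (max 2 (16 / a)) * Real.sqrt (27 + 2025 / 8 * a)))) := by
        gcongr
    _ ≤ 1 / 10 := h

-- decl-local heartbeat insurance (cell rule «decl-local ≤ 400000, never file-global»): long closed terms; measured under the default on the farm.
set_option maxHeartbeats 400000 in
/-- ★★ **THE PRINTED `δP` OF ✓`hloc_of_cube_rows` IS BOUNDED K-UNIFORMLY** (atom form: `M, sx, dEx` the member's raw letters with their pin values, `η ∈ (0,1]` inside the gap term,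
slopes `μ, μ′` with `10μ ≤ 1`, `0 < μ′ ≤ μ∕2`, `1∕μ′ ≤ ν̄`, the gap letters, any `cG cQ εN r`):
`δP ≤ δPmax(a, μ, μ′, ν̄, cG, cQ, εN, r)` — every window-dependent factor replaced as in ✓`Prop7LODSlotK2WindowLetters.big_le` (`(m_B²∕2 − 3GAP²)⁻¹e^{9μ′} ≤ 18∕m_B²`,
`8M√s·e^{3μ} ≤ 24M√s`, `1∕(μ−μ′) ≤ 2∕μ`, `1∕(μ′∕2) ≤ 2ν̄`), the tail `e^{−μ′r∕2}` kept. [cite: Balaban1985BackgroundPropagators, (3.49) p.399, (3.105)–(3.106) p.414] -/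
theorem deltaP_le {a sx dEx η M μ μ' ν cG cQ εN r : ℝ} (ha : 0 < a) (hsx : sx = 25 / 8) (hdEx : dEx = 600 * (27 / 4 : ℝ) ^ 6) (hM : M = max 2 (16 / a))
    (hμ0 : 0 < μ) (hμ1 : 10 * μ ≤ 1) (hμ'0 : 0 < μ') (hμ'μ : μ' ≤ μ / 2) (hν : 1 / μ' ≤ ν)
    (hP2 : ((2 / ((1 + sx) * (dEx + a))) ^ 2 / 2 - 3 * (Real.sqrt M * (2 + Real.sqrt M)
          * (Real.sqrt 3 * (η)⁻¹ * (Real.exp (μ' * η) - 1) + (Real.sqrt 3 * (η)⁻¹ * (Real.exp (μ' * η) - 1)) ^ 2 + Real.sqrt a * (Real.sqrt (sx)) * (Real.exp (3 * μ') - 1) + a * (Real.sqrt (sx)) ^ 2 * (Real.exp (3 * μ') - 1) ^ 2)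
          * (8 * Real.sqrt M + 8 * Real.sqrt M ^ 2)
          * ((Real.sqrt (sx)) * (1 + (Real.exp (3 * μ') - 1))) + M * ((Real.sqrt (sx)) * (Real.exp (3 * μ') - 1))) ^ 2)⁻¹ ≤ 6 / (2 / ((1 + sx) * (dEx + a))) ^ 2)
    (hP2pos : 0 < (2 / ((1 + sx) * (dEx + a))) ^ 2 / 2 - 3 * (Real.sqrt M * (2 + Real.sqrt M)
          * (Real.sqrt 3 * (η)⁻¹ * (Real.exp (μ' * η) - 1) + (Real.sqrt 3 * (η)⁻¹ * (Real.exp (μ' * η) - 1)) ^ 2 + Real.sqrt a * (Real.sqrt (sx)) * (Real.exp (3 * μ') - 1) + a * (Real.sqrt (sx)) ^ 2 * (Real.exp (3 * μ') - 1) ^ 2)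
          * (8 * Real.sqrt M + 8 * Real.sqrt M ^ 2)
          * ((Real.sqrt (sx)) * (1 + (Real.exp (3 * μ') - 1))) + M * ((Real.sqrt (sx)) * (Real.exp (3 * μ') - 1))) ^ 2) :
    ((Real.sqrt (sx) * cG + cQ) * ((2 / ((1 + sx) * (dEx + a))) ^ 2)⁻¹ * (Real.sqrt (sx) * M) + (Real.sqrt (sx) * M) * (((2 / ((1 + sx) * (dEx + a))) ^ 2)⁻¹ * (εN * (((2 / ((1 + sx) * (dEx + a))) ^ 2)⁻¹ * (Real.sqrt (sx) * M)) + (Real.sqrt (sx) * M ^ 2 * Real.sqrt (sx) + Real.sqrt (sx) * M ^ 2 * Real.sqrt (sx)) * ((((2 / ((1 + sx) * (dEx + a))) ^ 2 / 2 - 3 * ((Real.sqrt M * (2 + Real.sqrt M)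
          * (Real.sqrt 3 * (η)⁻¹ * (Real.exp (μ' * η) - 1) + (Real.sqrt 3 * (η)⁻¹ * (Real.exp (μ' * η) - 1)) ^ 2 + Real.sqrt a * (Real.sqrt (sx)) * (Real.exp (3 * μ') - 1) + a * (Real.sqrt (sx)) ^ 2 * (Real.exp (3 * μ') - 1) ^ 2)
          * (8 * Real.sqrt M + 8 * Real.sqrt M ^ 2)
          * ((Real.sqrt (sx)) * (1 + (Real.exp (3 * μ') - 1))) + M * ((Real.sqrt (sx)) * (Real.exp (3 * μ') - 1)))) ^ 2)⁻¹ * Real.exp (9 * μ')) * (8 * M * Real.sqrt (sx) * Real.exp (3 * μ)) * (4 * (2 * (1 + 1 / (μ - μ'))) ^ 3) * Real.sqrt ((2 * (1 + 1 / (μ' / 2))) ^ 3 * (4 * (2 * (1 + 1 / (μ' / 2))) ^ 3)) * Real.exp (-(μ' * r / 2))))) + (Real.sqrt (sx) * M) * ((2 / ((1 + sx) * (dEx + a))) ^ 2)⁻¹ * (Real.sqrt (sx) * cG + cQ))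
      ≤ ((Real.sqrt (25 / 8) * cG + cQ) * ((2 / ((1 + 25 / 8) * (600 * (27 / 4 : ℝ) ^ 6 + a))) ^ 2)⁻¹ * (Real.sqrt (25 / 8) * (max 2 (16 / a))) + (Real.sqrt (25 / 8) * (max 2 (16 / a))) * (((2 / ((1 + 25 / 8) * (600 * (27 / 4 : ℝ) ^ 6 + a))) ^ 2)⁻¹ * (εN * (((2 / ((1 + 25 / 8) * (600 * (27 / 4 : ℝ) ^ 6 + a))) ^ 2)⁻¹ * (Real.sqrt (25 / 8) * (max 2 (16 / a)))) + (Real.sqrt (25 / 8) * (max 2 (16 / a)) ^ 2 * Real.sqrt (25 / 8) + Real.sqrt (25 / 8) * (max 2 (16 / a)) ^ 2 * Real.sqrt (25 / 8)) * ((18 / (2 / ((1 + 25 / 8) * (600 * (27 / 4 : ℝ) ^ 6 + a))) ^ 2) * (24 * (max 2 (16 / a)) * Real.sqrt (25 / 8)) * (4 * (2 * (1 + 2 / μ)) ^ 3) * Real.sqrt ((2 * (1 + 2 * ν)) ^ 3 * (4 * (2 * (1 + 2 * ν)) ^ 3)) * Real.exp (-(μ' * r / 2))))) + (Real.sqrt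 (25 / 8) * (max 2 (16 / a))) * ((2 / ((1 + 25 / 8) * (600 * (27 / 4 : ℝ) ^ 6 + a))) ^ 2)⁻¹ * (Real.sqrt (25 / 8) * cG + cQ)) := by
  subst hsx hdEx hM
  -- small numeric facts first (cheap context)
  have hMge : (2 : ℝ) ≤ max 2 (16 / a) := le_max_left _ _
  have h3 : 3 * μ ≤ 1 := by linarith
  have h9 : 9 * μ' ≤ 1 := by linarith
  have hss : 0 ≤ Real.sqrt (25 / 8 : ℝ) := Real.sqrt_nonneg _
  have hM0 : 0 ≤ max 2 (16 / a) := by linarith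
  have he3 : Real.exp (3 * μ) ≤ 3 := by
    have := Real.exp_one_lt_d9; have h4 : Real.exp (3 * μ) ≤ Real.exp 1 := Real.exp_le_exp.2 h3; linarith
  have he9 : Real.exp (9 * μ') ≤ 3 := by
    have := Real.exp_one_lt_d9; have h4 : Real.exp (9 * μ') ≤ Real.exp 1 := Real.exp_le_exp.2 h9; linarith
  have hP1 : 8 * max 2 (16 / a) * Real.sqrt (25 / 8) * Real.exp (3 * μ) ≤ 24 * max 2 (16 / a) * Real.sqrt (25 / 8) := by
    calc 8 * max 2 (16 / a) * Real.sqrt (25 / 8) * Real.exp (3 * μ) ≤ 8 * max 2 (16 / a) * Real.sqrt (25 / 8) * 3 :=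
          mul_le_mul_of_nonneg_left he3 (by positivity)
      _ = 24 * max 2 (16 / a) * Real.sqrt (25 / 8) := by ring
  have hP3 : 4 * (2 * (1 + 1 / (μ - μ'))) ^ 3 ≤ 4 * (2 * (1 + 2 / μ)) ^ 3 := by
    have hd : 1 / (μ - μ') ≤ 2 / μ := by
      rw [div_le_div_iff₀ (by linarith) hμ0]; linarith
    have hd0 : 0 ≤ 1 / (μ - μ') := div_nonneg zero_le_one (by linarith)
    gcongr
  have hν0 : 0 < ν := lt_of_lt_of_le (by positivity) hν
  have h2ν : 2 / μ' ≤ 2 * ν := by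
    have e : 2 / μ' = 2 * (1 / μ') := by ring
    rw [e]; linarith
  have hinv2 : 1 / (μ' / 2) ≤ 2 * ν := by rw [one_div_div]; exact h2ν
  have hSQ : Real.sqrt ((2 * (1 + 1 / (μ' / 2))) ^ 3 * (4 * (2 * (1 + 1 / (μ' / 2))) ^ 3))
      ≤ Real.sqrt ((2 * (1 + 2 * ν)) ^ 3 * (4 * (2 * (1 + 2 * ν)) ^ 3)) := by
    apply Real.sqrt_le_sqrt
    have hq0 : 0 ≤ 1 / (μ' / 2) := by positivity
    gcongr
  have hmBc : (0 : ℝ) < (2 / ((1 + 25 / 8) * (600 * (27 / 4 : ℝ) ^ 6 + a))) := by positivity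
  have hP30 : (0 : ℝ) ≤ 4 * (2 * (1 + 1 / (μ - μ'))) ^ 3 := by
    have : (0 : ℝ) ≤ 1 / (μ - μ') := div_nonneg zero_le_one (by linarith)
    positivity
  -- the inverse letter of the B6 constant (type read off `hP2`, no re-spelling of the gap term)
  have hP2' := mul_le_mul hP2 he9 (Real.exp_pos _).le (le_trans (inv_pos.2 hP2pos).le hP2)
  have e18 : (6 : ℝ) / (2 / ((1 + 25 / 8) * (600 * (27 / 4 : ℝ) ^ 6 + a))) ^ 2 * 3 = 18 / (2 / ((1 + 25 / 8) * (600 * (27 / 4 : ℝ) ^ 6 + a))) ^ 2 := by ring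
  rw [e18] at hP2'
  -- assemble: only the window product inside the middle summand moves
  apply add_le_add (add_le_add le_rfl ?_) le_rfl
  apply mul_le_mul_of_nonneg_left _ (by positivity)
  apply mul_le_mul_of_nonneg_left _ (by positivity)
  apply add_le_add le_rfl
  apply mul_le_mul_of_nonneg_left _ (by positivity)
  apply mul_le_mul_of_nonneg_right _ (Real.exp_pos _).le
  exact mul_le_mul (mul_le_mul (mul_le_mul hP2' hP1 (by positivity) (by positivity)) hP3 hP30 (by positivity)) hSQ
    (Real.sqrt_nonneg _) (by positivity)

end Real

/-! ## §2 At the member: routeR-w2's `hloc` with NO B-series window letter displayed -/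

variable (F : T3Family) {n K : ℕ} (h : n ≤ K) {c₀ c₁ : ℝ} [Fact (0 < c₀)] [Fact (0 < c₁)]

include h in
-- decl-local heartbeat insurance (cell rule «decl-local ≤ 400000, never file-global»): a 40-binder knit over long closed terms.
set_option maxHeartbeats 400000 in
/-- ★★★ **routeR-w2 g13's `hloc` PER CUBE WITH THE WINDOW LETTERS DISCHARGED K-UNIFORMLY** — ✓`hloc_of_cube_rows` at the chair's pin-(2) coarse weight (`hc₁ : c₁ = c₀(L³)^{K−n}`),
slopes `(μ, μ′) := (μ(a), μ′(a))` and `δ₁ := √(27+(2025∕8)a)·μ`, `δ₁′ := √(…)·μ′` — the SAME closed choices as ✓`hKP_pin` — with `hδ hwin hδV hwinV hgapV` proved for every `η ∈ (0,1]`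
(✓`Prop7LODSlotK2WindowLetters`); conclusion = px10 g11's `hloc` binder of ✓`curvedTarget_member_of_hKP_hloc` with **`δP := δPmax(a, cG, cQ, εN, r)` a closed term of the massive mass,
px5 g11's three row constants and the near radius** (0 × `K − n` outside the displayed rows).  Displayed: `ι` at the pin, per-cube massive data `Qc Tc Gc`, flat data `Q1 T1 G1`, px5's
`hop hRB1 hRB2`, `r`. [cite: Balaban1985BackgroundPropagators, (3.20)–(3.26) pp.394–395, (3.49) p.399, (3.105)–(3.106) p.414; Balaban1988RG2Cluster, (2.7) p.13] -/
theorem hloc_pin (hc₁ : c₁ = c₀ * ((F.L : ℝ) ^ 3) ^ (K - n)) (hnK : n < K) {ε₀ : ℝ} (hε₀ : 0 < ε₀) (hε7 : 10 ^ 7 * (F.L : ℝ) ^ 3 * ε₀ ≤ 1)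
    (U₀ : GaugeField (F.P K) 0 (Matrix.specialUnitaryGroup (Fin 2) ℂ)) (hreg : RegPr F n K ε₀ U₀)
    (ι : (Site (F.P K) (K - n) → Matrix (Fin 2) (Fin 2) ℂ) →ₗ[ℂ] SiteL2K ℂ 3 (periodsT3 F n) c₁ W₂)
    (hι : ∀ c, ι c = toL2S F n c₁ (fun z => c (siteShift (sites_eq F n K h) z)))
    {a : ℝ} (ha : 0 < a) (s : ℕ) (r : ℝ)
    -- per-cube letters at the cube-gauged background
    (Qc : Site (F.P K) 0 → (SiteL2K ℂ 3 (periodsT3 F K) c₀ W₂ →ₗ[ℂ] (Site (F.P K) (K - n) → Matrix (Fin 2) (Fin 2) ℂ)))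
    (hseqc : ∀ c : Site (F.P K) 0, (∀ lam : Site (F.P K) 0 → Matrix (Fin 2) (Fin 2) ℂ, ∃ ns : (j : ℕ) → Site (F.P K) j → Matrix (Fin 2) (Fin 2) ℂ, ns 0 = lam ∧
        (∀ (j : ℕ) (y : Site (F.P K) (j + 1)), ns (j + 1) y = ns j (emb y) - meanCLM (Idx (F.P K)) (Matrix (Fin 2) (Fin 2) ℂ) fun i : Idx (F.P K) =>
          ns j (emb y) - ((holT (emlIterU j (bgUnits F K (GaugeField.gaugeAct (axialT U₀ c) U₀))) (emb y) (stairWord i.2.1 (off i.1)) : (Matrix (Fin 2) (Fin 2) ℂ)ˣ) : Matrix (Fin 2) (Fin 2) ℂ) *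
            ns j (transl (emb y) (disp (stairWord i.2.1 (off i.1)))) * (((holT (emlIterU j (bgUnits F K (GaugeField.gaugeAct (axialT U₀ c) U₀))) (emb y) (stairWord i.2.1 (off i.1)))⁻¹ : (Matrix (Fin 2) (Fin 2) ℂ)ˣ) : Matrix (Fin 2) (Fin 2) ℂ)) ∧
        ns (K - n) = Qc c (toL2S F K c₀ lam)))
    (Tc : Site (F.P K) 0 → (SiteL2K ℂ 3 (periodsT3 F n) c₁ W₂ →ₗ[ℂ] SiteL2K ℂ 3 (periodsT3 F K) c₀ W₂))
    (hTc : ∀ (c : Site (F.P K) 0) (l : SiteL2K ℂ 3 (periodsT3 F K) c₀ W₂) (f : SiteL2K ℂ 3 (periodsT3 F n) c₁ W₂), ⟪ι (Qc c l), f⟫_ℂ = ⟪l, Tc c f⟫_ℂ)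
    (Gc : Site (F.P K) 0 → (SiteL2K ℂ 3 (periodsT3 F K) c₀ W₂ →ₗ[ℂ] SiteL2K ℂ 3 (periodsT3 F K) c₀ W₂))
    (hAGc : ∀ (c : Site (F.P K) 0) (f : SiteL2K ℂ 3 (periodsT3 F K) c₀ W₂), covLapSite F n K c₀ (GaugeField.gaugeAct (axialT U₀ c) U₀) (Gc c f) + (a : ℂ) • Tc c (ι (Qc c (Gc c f))) = f)
    (hGAc : ∀ (c : Site (F.P K) 0) (w : SiteL2K ℂ 3 (periodsT3 F K) c₀ W₂), Gc c (covLapSite F n K c₀ (GaugeField.gaugeAct (axialT U₀ c) U₀) w + (a : ℂ) • Tc c (ι (Qc c w))) = w)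
    -- the flat system at background `1`
    (Q1 : SiteL2K ℂ 3 (periodsT3 F K) c₀ W₂ →ₗ[ℂ] (Site (F.P K) (K - n) → Matrix (Fin 2) (Fin 2) ℂ))
    (hseq₁ : (∀ lam : Site (F.P K) 0 → Matrix (Fin 2) (Fin 2) ℂ, ∃ ns : (j : ℕ) → Site (F.P K) j → Matrix (Fin 2) (Fin 2) ℂ, ns 0 = lam ∧
      (∀ (j : ℕ) (y : Site (F.P K) (j + 1)), ns (j + 1) y = ns j (emb y) - meanCLM (Idx (F.P K)) (Matrix (Fin 2) (Fin 2) ℂ) fun i : Idx (F.P K) =>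
        ns j (emb y) - ((holT (emlIterU j (bgUnits F K (1 : GaugeField (F.P K) 0 (Matrix.specialUnitaryGroup (Fin 2) ℂ)))) (emb y) (stairWord i.2.1 (off i.1)) : (Matrix (Fin 2) (Fin 2) ℂ)ˣ) : Matrix (Fin 2) (Fin 2) ℂ) *
          ns j (transl (emb y) (disp (stairWord i.2.1 (off i.1)))) * (((holT (emlIterU j (bgUnits F K (1 : GaugeField (F.P K) 0 (Matrix.specialUnitaryGroup (Fin 2) ℂ)))) (emb y) (stairWord i.2.1 (off i.1)))⁻¹ : (Matrix (Fin 2) (Fin 2) ℂ)ˣ) : Matrix (Fin 2) (Fin 2) ℂ)) ∧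
      ns (K - n) = Q1 (toL2S F K c₀ lam)))
    (T1 : SiteL2K ℂ 3 (periodsT3 F n) c₁ W₂ →ₗ[ℂ] SiteL2K ℂ 3 (periodsT3 F K) c₀ W₂) (hT1 : ∀ (l : SiteL2K ℂ 3 (periodsT3 F K) c₀ W₂) (f : SiteL2K ℂ 3 (periodsT3 F n) c₁ W₂), ⟪ι (Q1 l), f⟫_ℂ = ⟪l, T1 f⟫_ℂ)
    (G1 : SiteL2K ℂ 3 (periodsT3 F K) c₀ W₂ →ₗ[ℂ] SiteL2K ℂ 3 (periodsT3 F K) c₀ W₂)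
    (hAG1 : ∀ f, covLapSite F n K c₀ (1 : GaugeField (F.P K) 0 (Matrix.specialUnitaryGroup (Fin 2) ℂ)) (G1 f) + (a : ℂ) • T1 (ι (Q1 (G1 f))) = f)
    (hGA1 : ∀ w, G1 (covLapSite F n K c₀ (1 : GaugeField (F.P K) 0 (Matrix.specialUnitaryGroup (Fin 2) ℂ)) w + (a : ℂ) • T1 (ι (Q1 w))) = w)
    -- the three px5-class rows per cube
    {cG cQ εN : ℝ} (hcG : 0 ≤ cG) (hcQ : 0 ≤ cQ) (hεN : 0 ≤ εN)
    (hop : ∀ (c : Site (F.P K) 0) (db : Site (F.P K) (K - n) → Matrix (Fin 2) (Fin 2) ℂ),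
      (∀ z, db z ≠ 0 → ∃ z' ∈ (Finset.univ.filter fun z : Site (F.P K) (K - n) => Site.tdist z (iterBlockOf (K - n) c) ≤ 3 * F.L ^ s + 4), (Site.tdist (P := F.P K) z' z : ℝ) < r) →
        ‖ι (Q1 (G1 (G1 (T1 (ι db))))) - ι (Qc c (Gc c (Gc c (Tc c (ι db)))))‖ ≤ εN * ‖ι db‖)
    (hRB1 : ∀ (c : Site (F.P K) 0) (X : PBond (F.P K) 0 → Matrix (Fin 2) (Fin 2) ℂ),
      (∀ b : PBond (F.P K) 0, X b ≠ 0 → Site.tdist c b.src ≤ (3 * (F.L ^ s * F.L ^ (K - n)))) →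
        ‖Gc c (DstarL2 F n K c₀ (GaugeField.gaugeAct (axialT U₀ c) U₀) (toL2 F K c₀ (fun b => ((axialT U₀ c b.src : Matrix.specialUnitaryGroup (Fin 2) ℂ) : Matrix (Fin 2) (Fin 2) ℂ) * X b * star ((axialT U₀ c b.src : Matrix.specialUnitaryGroup (Fin 2) ℂ) : Matrix (Fin 2) (Fin 2) ℂ)))) - G1 (DstarL2 F n K c₀ (GaugeField.gaugeAct (axialT U₀ c) U₀) (toL2 F K c₀ (fun b => ((axialT U₀ c b.src : Matrix.specialUnitaryGroup (Fin 2) ℂ) : Matrix (Fin 2) (Fin 2) ℂ) * X b * star ((axialT U₀ c b.src : Matrix.specialUnitaryGroup (Fin 2) ℂ) : Matrix (Fin 2) (Fin 2) ℂ))))‖ ≤ cG * ‖DstarL2 F n K c₀ (GaugeField.gaugeAct (axialT U₀ c) U₀) (toL2 F K c₀ (fun b => ((axialT U₀ c b.src : Matrix.specialUnitaryGroup (Fin 2) ℂ) : Matrix (Fin 2) (Fin 2) ℂ) * X b * star ((axialT U₀ c b.src : Matrix.specialUnitaryGroup (Fin 2) ℂ) : Matrix (Fin 2) (Fin 2) 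ℂ)))‖)
    (hRB2 : ∀ (c : Site (F.P K) 0) (X : PBond (F.P K) 0 → Matrix (Fin 2) (Fin 2) ℂ),
      (∀ b : PBond (F.P K) 0, X b ≠ 0 → Site.tdist c b.src ≤ (3 * (F.L ^ s * F.L ^ (K - n)))) →
        ‖ι (Qc c (G1 (DstarL2 F n K c₀ (GaugeField.gaugeAct (axialT U₀ c) U₀) (toL2 F K c₀ (fun b => ((axialT U₀ c b.src : Matrix.specialUnitaryGroup (Fin 2) ℂ) : Matrix (Fin 2) (Fin 2) ℂ) * X b * star ((axialT U₀ c b.src : Matrix.specialUnitaryGroup (Fin 2) ℂ) : Matrix (Fin 2) (Fin 2) ℂ)))))) - ι (Q1 (G1 (DstarL2 F n K c₀ (GaugeField.gaugeAct (axialT U₀ c) U₀) (toL2 F K c₀ (fun b => ((axialT U₀ c b.src : Matrix.specialUnitaryGroup (Fin 2) ℂ) : Matrix (Fin 2) (Fin 2) ℂ) * X b * star ((axialT U₀ c b.src : Matrix.specialUnitaryGroup (Fin 2) ℂ) : Matrix (Fin 2) (Fin 2) ℂ))))))‖ ≤ cQ * ‖DstarL2 F n K c₀ (GaugeField.gaugeAct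 (axialT U₀ c) U₀) (toL2 F K c₀ (fun b => ((axialT U₀ c b.src : Matrix.specialUnitaryGroup (Fin 2) ℂ) : Matrix (Fin 2) (Fin 2) ℂ) * X b * star ((axialT U₀ c b.src : Matrix.specialUnitaryGroup (Fin 2) ℂ) : Matrix (Fin 2) (Fin 2) ℂ)))‖) :
    ∀ c : Site (F.P K) 0, ∃ Qc : SiteL2K ℂ 3 (periodsT3 F K) c₀ W₂ →ₗ[ℂ] (Site (F.P K) (K - n) → Matrix (Fin 2) (Fin 2) ℂ),
      (∀ lam : Site (F.P K) 0 → Matrix (Fin 2) (Fin 2) ℂ, ∃ ns : (j : ℕ) → Site (F.P K) j → Matrix (Fin 2) (Fin 2) ℂ, ns 0 = lam ∧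
        (∀ (j : ℕ) (y : Site (F.P K) (j + 1)), ns (j + 1) y = ns j (emb y) - meanCLM (Idx (F.P K)) (Matrix (Fin 2) (Fin 2) ℂ) fun i : Idx (F.P K) =>
          ns j (emb y) - ((holT (emlIterU j (bgUnits F K (GaugeField.gaugeAct (axialT U₀ c) U₀))) (emb y) (stairWord i.2.1 (off i.1)) : (Matrix (Fin 2) (Fin 2) ℂ)ˣ) : Matrix (Fin 2) (Fin 2) ℂ) *
            ns j (transl (emb y) (disp (stairWord i.2.1 (off i.1)))) * (((holT (emlIterU j (bgUnits F K (GaugeField.gaugeAct (axialT U₀ c) U₀))) (emb y) (stairWord i.2.1 (off i.1)))⁻¹ : (Matrix (Fin 2) (Fin 2) ℂ)ˣ) : Matrix (Fin 2) (Fin 2) ℂ)) ∧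
        ns (K - n) = Qc (toL2S F K c₀ lam)) ∧
      ∀ X : PBond (F.P K) 0 → Matrix (Fin 2) (Fin 2) ℂ, (∀ b : PBond (F.P K) 0, X b ≠ 0 → Site.tdist c b.src ≤ (3 * (F.L ^ s * F.L ^ (K - n)))) →
        ‖⟪DstarL2 F n K c₀ (GaugeField.gaugeAct (axialT U₀ c) U₀) (toL2 F K c₀ (fun b => ((axialT U₀ c b.src : Matrix.specialUnitaryGroup (Fin 2) ℂ) : Matrix (Fin 2) (Fin 2) ℂ) * X b * star ((axialT U₀ c b.src : Matrix.specialUnitaryGroup (Fin 2) ℂ) : Matrix (Fin 2) (Fin 2) ℂ))),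
            (DstarL2 F n K c₀ (GaugeField.gaugeAct (axialT U₀ c) U₀) (toL2 F K c₀ (fun b => ((axialT U₀ c b.src : Matrix.specialUnitaryGroup (Fin 2) ℂ) : Matrix (Fin 2) (Fin 2) ℂ) * X b * star ((axialT U₀ c b.src : Matrix.specialUnitaryGroup (Fin 2) ℂ) : Matrix (Fin 2) (Fin 2) ℂ))) - projR (covLapSite F n K c₀ (GaugeField.gaugeAct (axialT U₀ c) U₀)) Qc (DstarL2 F n K c₀ (GaugeField.gaugeAct (axialT U₀ c) U₀) (toL2 F K c₀ (fun b => ((axialT U₀ c b.src : Matrix.specialUnitaryGroup (Fin 2) ℂ) : Matrix (Fin 2) (Fin 2) ℂ) * X b * star ((axialT U₀ c b.src : Matrix.specialUnitaryGroup (Fin 2) ℂ) : Matrix (Fin 2) (Fin 2) ℂ)))))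
            - (DstarL2 F n K c₀ (GaugeField.gaugeAct (axialT U₀ c) U₀) (toL2 F K c₀ (fun b => ((axialT U₀ c b.src : Matrix.specialUnitaryGroup (Fin 2) ℂ) : Matrix (Fin 2) (Fin 2) ℂ) * X b * star ((axialT U₀ c b.src : Matrix.specialUnitaryGroup (Fin 2) ℂ) : Matrix (Fin 2) (Fin 2) ℂ))) - projR (covLapSite F n K c₀ 1) Q1 (DstarL2 F n K c₀ (GaugeField.gaugeAct (axialT U₀ c) U₀) (toL2 F K c₀ (fun b => ((axialT U₀ c b.src : Matrix.specialUnitaryGroup (Fin 2) ℂ) : Matrix (Fin 2) (Fin 2) ℂ) * X b * star ((axialT U₀ c b.src : Matrix.specialUnitaryGroup (Fin 2) ℂ) : Matrix (Fin 2) (Fin 2) ℂ)))))⟫_ℂ‖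
          ≤ ((Real.sqrt (25 / 8) * cG + cQ) * ((2 / ((1 + 25 / 8) * (600 * (27 / 4 : ℝ) ^ 6 + a))) ^ 2)⁻¹ * (Real.sqrt (25 / 8) * (max 2 (16 / a))) + (Real.sqrt (25 / 8) * (max 2 (16 / a))) * (((2 / ((1 + 25 / 8) * (600 * (27 / 4 : ℝ) ^ 6 + a))) ^ 2)⁻¹ * (εN * (((2 / ((1 + 25 / 8) * (600 * (27 / 4 : ℝ) ^ 6 + a))) ^ 2)⁻¹ * (Real.sqrt (25 / 8) * (max 2 (16 / a)))) + (Real.sqrt (25 / 8) * (max 2 (16 / a)) ^ 2 * Real.sqrt (25 / 8) + Real.sqrt (25 / 8) * (max 2 (16 / a)) ^ 2 * Real.sqrt (25 / 8)) * ((18 / (2 / ((1 + 25 / 8) * (600 * (27 / 4 : ℝ) ^ 6 + a))) ^ 2) * (24 * (max 2 (16 / a)) * Real.sqrt (25 / 8)) * (4 * (2 * (1 + 2 / (1 / (10 * Real.sqrt (max 2 (16 / a)) * Real.sqrt (27 + 2025 / 8 * a))))) ^ 3) * Real.sqrt ((2 * (1 + 2 * (2 / (1 / (10 * Real.sqrt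 (max 2 (16 / a)) * Real.sqrt (27 + 2025 / 8 * a))) + 3 * ((Real.sqrt (max 2 (16 / a)) * (2 + Real.sqrt (max 2 (16 / a))) * (3 * Real.sqrt 3 + 27 + 9 * Real.sqrt a * Real.sqrt (25 / 8) + 81 * a * (25 / 8))
          * (8 * Real.sqrt (max 2 (16 / a)) + 8 * Real.sqrt (max 2 (16 / a)) ^ 2) * (10 * Real.sqrt (25 / 8)) + 9 * (max 2 (16 / a)) * Real.sqrt (25 / 8))) / (2 / ((1 + 25 / 8) * (600 * (27 / 4 : ℝ) ^ 6 + a)))))) ^ 3 * (4 * (2 * (1 + 2 * (2 / (1 / (10 * Real.sqrt (max 2 (16 / a)) * Real.sqrt (27 + 2025 / 8 * a))) + 3 * ((Real.sqrt (max 2 (16 / a)) * (2 + Real.sqrt (max 2 (16 / a))) * (3 * Real.sqrt 3 + 27 + 9 * Real.sqrt a * Real.sqrt (25 / 8) + 81 * a * (25 / 8))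
          * (8 * Real.sqrt (max 2 (16 / a)) + 8 * Real.sqrt (max 2 (16 / a)) ^ 2) * (10 * Real.sqrt (25 / 8)) + 9 * (max 2 (16 / a)) * Real.sqrt (25 / 8))) / (2 / ((1 + 25 / 8) * (600 * (27 / 4 : ℝ) ^ 6 + a)))))) ^ 3)) * Real.exp (-((min ((1 / (10 * Real.sqrt (max 2 (16 / a)) * Real.sqrt (27 + 2025 / 8 * a))) / 2) ((2 / ((1 + 25 / 8) * (600 * (27 / 4 : ℝ) ^ 6 + a))) / (3 * ((Real.sqrt (max 2 (16 / a)) * (2 + Real.sqrt (max 2 (16 / a))) * (3 * Real.sqrt 3 + 27 + 9 * Real.sqrt a * Real.sqrt (25 / 8) + 81 * a * (25 / 8))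
          * (8 * Real.sqrt (max 2 (16 / a)) + 8 * Real.sqrt (max 2 (16 / a)) ^ 2) * (10 * Real.sqrt (25 / 8)) + 9 * (max 2 (16 / a)) * Real.sqrt (25 / 8)))))) * r / 2))))) + (Real.sqrt (25 / 8) * (max 2 (16 / a))) * ((2 / ((1 + 25 / 8) * (600 * (27 / 4 : ℝ) ^ 6 + a))) ^ 2)⁻¹ * (Real.sqrt (25 / 8) * cG + cQ))
          * ‖DstarL2 F n K c₀ (GaugeField.gaugeAct (axialT U₀ c) U₀) (toL2 F K c₀ (fun b => ((axialT U₀ c b.src : Matrix.specialUnitaryGroup (Fin 2) ℂ) : Matrix (Fin 2) (Fin 2) ℂ) * X b * star ((axialT U₀ c b.src : Matrix.specialUnitaryGroup (Fin 2) ℂ) : Matrix (Fin 2) (Fin 2) ℂ)))‖ ^ 2  := by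
  have hc₀ : 0 < c₀ := Fact.out
  have hL1 : (1 : ℝ) < F.L := by exact_mod_cast F.hL.2
  have hL0 : (0 : ℝ) < F.L := by linarith
  -- the chair's pins at `c₁ = c₀(L³)^(K−n)`
  have hsx : (25 / 8) * (c₁ * ((((F.P K).L : ℝ) ^ (F.P K).d) ^ (K - n))⁻¹ / c₀) = 25 / 8 := by
    rw [hc₁, show ((F.P K).L : ℝ) = (F.L : ℝ) from rfl, T3Family.P_d]; field_simp
  have hMraw : 16 * c₀ * ((F.L : ℝ) ^ (K - n)) ^ 3 / (a * c₁) = 16 / a := by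
    rw [hc₁, ← pow_mul, ← pow_mul, Nat.mul_comm]; field_simp
  have hM : max 2 (16 * c₀ * ((F.L : ℝ) ^ (K - n)) ^ 3 / (a * c₁)) = max 2 (16 / a) := by rw [hMraw]
  have hdEx : 600 * (27 / 4 : ℝ) ^ 6 * (c₀ * ((F.L : ℝ) ^ 3) ^ (K - n) / c₁) = 600 * (27 / 4 : ℝ) ^ 6 := by
    rw [hc₁, div_self (by positivity), mul_one]
  have hη : 0 < eta F n K := eta_pos F n K
  have hη1 : eta F n K ≤ 1 := by
    show ((F.L : ℝ)⁻¹) ^ (K - n) ≤ 1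
    exact pow_le_one₀ (inv_nonneg.2 hL0.le) (inv_le_one_of_one_le₀ hL1.le)
  -- the closed letters of the massive mass `a`
  set M' : ℝ := max 2 (16 / a) with hM'def
  have hM'2 : 2 ≤ M' := le_max_left _ _
  set cδ : ℝ := 27 + 2025 / 8 * a with hcδdef
  have hcδ1 : 1 ≤ cδ := by rw [hcδdef]; linarith [ha.le]
  set μ : ℝ := 1 / (10 * Real.sqrt M' * Real.sqrt cδ) with hμdef
  have hsM1 : 1 ≤ Real.sqrt M' := Real.one_le_sqrt.2 (by linarith)
  have hsc1 : 1 ≤ Real.sqrt cδ := Real.one_le_sqrt.2 hcδ1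
  have hμ0 : 0 < μ := by rw [hμdef]; positivity
  have hμ10 : 10 * μ ≤ 1 := by
    rw [hμdef]
    have h1 : (1 : ℝ) ≤ Real.sqrt M' * Real.sqrt cδ := one_le_mul_of_one_le_of_one_le hsM1 hsc1
    rw [show 10 * (1 / (10 * Real.sqrt M' * Real.sqrt cδ)) = 1 / (Real.sqrt M' * Real.sqrt cδ) by field_simp]
    rw [div_le_one (by positivity)]
    exact h1
  have hμ3 : 3 * μ ≤ 1 := by linarith
  set Γ : ℝ := (Real.sqrt (max 2 (16 / a)) * (2 + Real.sqrt (max 2 (16 / a))) * (3 * Real.sqrt 3 + 27 + 9 * Real.sqrt a * Real.sqrt (25 / 8) + 81 * a * (25 / 8))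
          * (8 * Real.sqrt (max 2 (16 / a)) + 8 * Real.sqrt (max 2 (16 / a)) ^ 2) * (10 * Real.sqrt (25 / 8)) + 9 * (max 2 (16 / a)) * Real.sqrt (25 / 8)) with hΓdef
  have hΓ : 0 < Γ := by rw [hΓdef]; positivity
  set mBc : ℝ := (2 / ((1 + 25 / 8) * (600 * (27 / 4 : ℝ) ^ 6 + a))) with hmBcdef
  have hmBc : 0 < mBc := by rw [hmBcdef]; positivity
  set μ' : ℝ := min (μ / 2) (mBc / (3 * Γ)) with hμ'def
  have hμ'0 : 0 < μ' := lt_min (by linarith) (by positivity)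
  have hμ'le : μ' ≤ μ / 2 := min_le_left _ _
  have hμ'lt : μ' < μ := by linarith
  have hμ'leμ : μ' ≤ μ := hμ'lt.le
  have hμ'3 : 3 * μ' ≤ 1 := by linarith
  have hμ'Γ' : μ' ≤ mBc / (3 * Γ) := min_le_right _ _
  set ν : ℝ := 2 / μ + 3 * Γ / mBc with hνdef
  have hν : 1 / μ' ≤ ν := by
    rw [one_div, hμ'def, hνdef]
    have h2μ : (0 : ℝ) < 2 / μ := by positivity
    have h3Γ : (0 : ℝ) < 3 * Γ / mBc := by positivity
    rcases le_total (μ / 2) (mBc / (3 * Γ)) with hle | hle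
    · rw [min_eq_left hle, inv_div]; linarith
    · rw [min_eq_right hle, inv_div]; linarith
  -- the window rows at the raw letters (slope μ and slope μ′)
  have hδ := window_delta (a := a) (sx := ((25 / 8) * (c₁ * ((((F.P K).L : ℝ) ^ (F.P K).d) ^ (K - n))⁻¹ / c₀))) (η := eta F n K) ha hsx hη hη1 hμ0.le hμ3
  have hwin := window_win ha hM
  have hδV := window_delta (a := a) (sx := ((25 / 8) * (c₁ * ((((F.P K).L : ℝ) ^ (F.P K).d) ^ (K - n))⁻¹ / c₀))) (η := eta F n K) ha hsx hη hη1 hμ'0.le hμ'3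
  have hwinV := window_win_le ha hM hμ'leμ
  have hG0 := gap_nonneg (a := a) (sx := ((25 / 8) * (c₁ * ((((F.P K).L : ℝ) ^ (F.P K).d) ^ (K - n))⁻¹ / c₀))) (η := eta F n K)
    (M := max 2 (16 * c₀ * ((F.L : ℝ) ^ (K - n)) ^ 3 / (a * c₁))) (μ' := μ') ha hη (by positivity) hμ'0.le
  have hGle := gap_le (a := a) (sx := ((25 / 8) * (c₁ * ((((F.P K).L : ℝ) ^ (F.P K).d) ^ (K - n))⁻¹ / c₀))) (η := eta F n K)
    (M := max 2 (16 * c₀ * ((F.L : ℝ) ^ (K - n)) ^ 3 / (a * c₁))) (μ' := μ') ha hsx hη hη1 hM hμ'0.le hμ'3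
  have hmBraw : (2 / ((1 + ((25 / 8) * (c₁ * ((((F.P K).L : ℝ) ^ (F.P K).d) ^ (K - n))⁻¹ / c₀))) * ((600 * (27 / 4 : ℝ) ^ 6 * (c₀ * ((F.L : ℝ) ^ 3) ^ (K - n) / c₁)) + a))) = mBc := by
    rw [hsx, hdEx]
  have hμ'Γ : μ' ≤ (2 / ((1 + ((25 / 8) * (c₁ * ((((F.P K).L : ℝ) ^ (F.P K).d) ^ (K - n))⁻¹ / c₀))) * ((600 * (27 / 4 : ℝ) ^ 6 * (c₀ * ((F.L : ℝ) ^ 3) ^ (K - n) / c₁)) + a))) / (3 * Γ) := by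
    rw [hmBraw]; exact hμ'Γ'
  obtain ⟨hgapV, hP2pos, hP2⟩ := window_gap hG0 hGle hΓ (by rw [hmBraw]; exact hmBc) hμ'Γ
  -- the K-free bound of the printed δP
  have hdP := deltaP_le (a := a) (sx := ((25 / 8) * (c₁ * ((((F.P K).L : ℝ) ^ (F.P K).d) ^ (K - n))⁻¹ / c₀))) (dEx := (600 * (27 / 4 : ℝ) ^ 6 * (c₀ * ((F.L : ℝ) ^ 3) ^ (K - n) / c₁))) (η := eta F n K)
    (M := max 2 (16 * c₀ * ((F.L : ℝ) ^ (K - n)) ^ 3 / (a * c₁))) (μ := μ) (μ' := μ') (ν := ν) (cG := cG) (cQ := cQ) (εN := εN) (r := r)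
    ha hsx hdEx hM hμ0 hμ10 hμ'0 hμ'le hν hP2 hP2pos
  -- routeR-w2's knit at these letters
  have hrow := hloc_of_cube_rows F h hnK hε₀ hε7 U₀ hreg ι hι ha s r Qc hseqc Tc hTc Gc hAGc hGAc Q1 hseq₁ T1 hT1 G1 hAG1 hGA1
    hμ'0 hμ'lt (δ₁ := Real.sqrt cδ * μ) (by positivity) hδ hwin (δ₁' := Real.sqrt cδ * μ') (by positivity) hδV hwinV hgapV hcG hcQ hεN hop hRB1 hRB2
  intro c
  obtain ⟨Q', hQ', hrowc⟩ := hrow c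
  refine ⟨Q', hQ', fun X hX => (hrowc X hX).trans ?_⟩
  exact mul_le_mul_of_nonneg_right hdP (sq_nonneg _)

/-! ## §3 (v1.1 append) The budget: `δPmax ≤ t` from four quarter-budgets — the ε₀∕radius antecedents px10 g11's `hT_exists` wants -/

section Budget

/-- **ABSTRACT QUARTER-BUDGET** (atoms `s M mi W μ′` positive, `t > 0`): if `cG ≤ t∕(8·s·A)`, `cQ ≤ t∕(8·A)`, `εN ≤ t∕(4·B)` and `(2∕μ′)·log(4D∕t) ≤ r` with `A = mi·(s·M)`,
`B = (s·M)·(mi·(mi·(s·M)))`, `D = (s·M)·(mi·((s·M²·s + s·M²·s)·W))`, then the `δPmax`-shaped sum is `≤ t` (each of its four pieces `≤ t∕4`; the tail by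
`e^{−μ′r∕2} ≤ e^{−log(4D∕t)} = t∕(4D)`). [cite: Balaban1985BackgroundPropagators, (3.49) p.399] -/
theorem budget_of_quarters {s M mi W μ' t cG cQ εN r : ℝ} (hs : 0 < s) (hM : 0 < M) (hmi : 0 < mi) (hW : 0 < W) (hμ' : 0 < μ') (ht : 0 < t)
    (hcG : cG ≤ t / (8 * s * (mi * (s * M)))) (hcQ : cQ ≤ t / (8 * (mi * (s * M))))
    (hεN : εN ≤ t / (4 * ((s * M) * (mi * (mi * (s * M))))))
    (hr : 2 / μ' * Real.log (4 * ((s * M) * (mi * ((s * M ^ 2 * s + s * M ^ 2 * s) * (W)))) / t) ≤ r) :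
    (s * cG + cQ) * mi * (s * M) + (s * M) * (mi * (εN * (mi * (s * M)) + (s * M ^ 2 * s + s * M ^ 2 * s) * (W * Real.exp (-(μ' * r / 2))))) + (s * M) * mi * (s * cG + cQ) ≤ t := by
  set A : ℝ := mi * (s * M) with hA
  have hA0 : 0 < A := by rw [hA]; positivity
  set B : ℝ := (s * M) * (mi * (mi * (s * M))) with hB
  have hB0 : 0 < B := by rw [hB]; positivity
  set D : ℝ := (s * M) * (mi * ((s * M ^ 2 * s + s * M ^ 2 * s) * W)) with hD
  have hD0 : 0 < D := by rw [hD]; positivity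
  -- the two `(s·cG + cQ)·A` pieces
  have h1 : (s * cG + cQ) * A ≤ t / 4 := by
    have e1 : s * cG ≤ s * (t / (8 * s * A)) := mul_le_mul_of_nonneg_left hcG hs.le
    have e2 : s * (t / (8 * s * A)) = t / (8 * A) := by field_simp
    have e3 : (s * cG + cQ) ≤ t / (8 * A) + t / (8 * A) := by linarith [e1, e2]
    calc (s * cG + cQ) * A ≤ (t / (8 * A) + t / (8 * A)) * A := mul_le_mul_of_nonneg_right e3 hA0.le
      _ = t / 4 := by field_simp; ring
  -- the middle summand = εN·B + D·e^{−μ′r∕2}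
  have hsplit : (s * M) * (mi * (εN * (mi * (s * M)) + (s * M ^ 2 * s + s * M ^ 2 * s) * (W * Real.exp (-(μ' * r / 2)))))
      = εN * B + D * Real.exp (-(μ' * r / 2)) := by rw [hB, hD]; ring
  have h2 : εN * B ≤ t / 4 := by
    calc εN * B ≤ t / (4 * B) * B := mul_le_mul_of_nonneg_right hεN hB0.le
      _ = t / 4 := by field_simp
  have h4 : D * Real.exp (-(μ' * r / 2)) ≤ t / 4 := by
    have hlog : Real.log (4 * D / t) ≤ μ' * r / 2 := by
      have := mul_le_mul_of_nonneg_left hr (le_of_lt (half_pos hμ'))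
      rw [show μ' / 2 * (2 / μ' * Real.log (4 * D / t)) = Real.log (4 * D / t) by field_simp] at this
      linarith
    have hex : Real.exp (-(μ' * r / 2)) ≤ t / (4 * D) := by
      calc Real.exp (-(μ' * r / 2)) ≤ Real.exp (-Real.log (4 * D / t)) := Real.exp_le_exp.2 (by linarith)
        _ = t / (4 * D) := by rw [Real.exp_neg, Real.exp_log (by positivity), inv_div]
    calc D * Real.exp (-(μ' * r / 2)) ≤ D * (t / (4 * D)) := mul_le_mul_of_nonneg_left hex hD0.le
      _ = t / 4 := by field_simp
  have h1' : (s * cG + cQ) * mi * (s * M) = (s * cG + cQ) * A := by rw [hA]; ring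
  have h3' : (s * M) * mi * (s * cG + cQ) = (s * cG + cQ) * A := by rw [hA]; ring
  rw [hsplit, h1', h3']
  linarith [h1, h2, h4]

-- decl-local heartbeat insurance (cell rule «decl-local ≤ 400000, never file-global»): long closed terms.
set_option maxHeartbeats 400000 in
/-- ★★ **THE BUDGET OF `hloc_pin`'s CONSTANT** — `δPmax(a, cG, cQ, εN, r) ≤ t` as soon as px5's three row constants and the near radius meet the four quarter-budgets
`cG ≤ t∕(8·√(25∕8)·A(a))`, `cQ ≤ t∕(8·A(a))`, `εN ≤ t∕(4·B(a))`, `r₀(a,t) := (2∕μ′(a))·log(4·D(a)∕t) ≤ r` (`A, B, D, μ′` CLOSED in `a` — read them off the statement) — these ARE the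
ε₀- and radius-antecedents of px10 g11's `hT_exists` (`min`∕`max` entries), w2 g12's `budget_theta` target being `t := g∕(64(c₆+1))`. [cite: Balaban1985BackgroundPropagators, (3.49) p.399] -/
theorem deltaPmax_le_of_budget {a t cG cQ εN r : ℝ} (ha : 0 < a) (ht : 0 < t)
    (hcG : cG ≤ t / (8 * Real.sqrt (25 / 8) * (((2 / ((1 + 25 / 8) * (600 * (27 / 4 : ℝ) ^ 6 + a))) ^ 2)⁻¹ * (Real.sqrt (25 / 8) * (max 2 (16 / a))))))
    (hcQ : cQ ≤ t / (8 * (((2 / ((1 + 25 / 8) * (600 * (27 / 4 : ℝ) ^ 6 + a))) ^ 2)⁻¹ * (Real.sqrt (25 / 8) * (max 2 (16 / a))))))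
    (hεN : εN ≤ t / (4 * ((Real.sqrt (25 / 8) * (max 2 (16 / a))) * (((2 / ((1 + 25 / 8) * (600 * (27 / 4 : ℝ) ^ 6 + a))) ^ 2)⁻¹ * (((2 / ((1 + 25 / 8) * (600 * (27 / 4 : ℝ) ^ 6 + a))) ^ 2)⁻¹ * (Real.sqrt (25 / 8) * (max 2 (16 / a))))))))
    (hr : 2 / (min ((1 / (10 * Real.sqrt (max 2 (16 / a)) * Real.sqrt (27 + 2025 / 8 * a))) / 2) ((2 / ((1 + 25 / 8) * (600 * (27 / 4 : ℝ) ^ 6 + a))) / (3 * ((Real.sqrt (max 2 (16 / a)) * (2 + Real.sqrt (max 2 (16 / a))) * (3 * Real.sqrt 3 + 27 + 9 * Real.sqrt a * Real.sqrt (25 / 8) + 81 * a * (25 / 8))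
          * (8 * Real.sqrt (max 2 (16 / a)) + 8 * Real.sqrt (max 2 (16 / a)) ^ 2) * (10 * Real.sqrt (25 / 8)) + 9 * (max 2 (16 / a)) * Real.sqrt (25 / 8)))))) * Real.log (4 * ((Real.sqrt (25 / 8) * (max 2 (16 / a))) * (((2 / ((1 + 25 / 8) * (600 * (27 / 4 : ℝ) ^ 6 + a))) ^ 2)⁻¹ * ((Real.sqrt (25 / 8) * (max 2 (16 / a)) ^ 2 * Real.sqrt (25 / 8) + Real.sqrt (25 / 8) * (max 2 (16 / a)) ^ 2 * Real.sqrt (25 / 8)) * ((18 / (2 / ((1 + 25 / 8) * (600 * (27 / 4 : ℝ) ^ 6 + a))) ^ 2) * (24 * (max 2 (16 / a)) * Real.sqrt (25 / 8)) * (4 * (2 * (1 + 2 / (1 / (10 * Real.sqrt (max 2 (16 / a)) * Real.sqrt (27 + 2025 / 8 * a))))) ^ 3) * Real.sqrt ((2 * (1 + 2 * (2 / (1 / (10 * Real.sqrt (max 2 (16 / a)) * Real.sqrt (27 + 2025 / 8 * a))) + 3 * ((Real.sqrt (max 2 (16 / a)) * (2 + Real.sqrt (max 2 (16 / a))) * (3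 * Real.sqrt 3 + 27 + 9 * Real.sqrt a * Real.sqrt (25 / 8) + 81 * a * (25 / 8))
          * (8 * Real.sqrt (max 2 (16 / a)) + 8 * Real.sqrt (max 2 (16 / a)) ^ 2) * (10 * Real.sqrt (25 / 8)) + 9 * (max 2 (16 / a)) * Real.sqrt (25 / 8))) / (2 / ((1 + 25 / 8) * (600 * (27 / 4 : ℝ) ^ 6 + a)))))) ^ 3 * (4 * (2 * (1 + 2 * (2 / (1 / (10 * Real.sqrt (max 2 (16 / a)) * Real.sqrt (27 + 2025 / 8 * a))) + 3 * ((Real.sqrt (max 2 (16 / a)) * (2 + Real.sqrt (max 2 (16 / a))) * (3 * Real.sqrt 3 + 27 + 9 * Real.sqrt a * Real.sqrt (25 / 8) + 81 * a * (25 / 8))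
          * (8 * Real.sqrt (max 2 (16 / a)) + 8 * Real.sqrt (max 2 (16 / a)) ^ 2) * (10 * Real.sqrt (25 / 8)) + 9 * (max 2 (16 / a)) * Real.sqrt (25 / 8))) / (2 / ((1 + 25 / 8) * (600 * (27 / 4 : ℝ) ^ 6 + a)))))) ^ 3)))))) / t) ≤ r) :
    ((Real.sqrt (25 / 8) * cG + cQ) * ((2 / ((1 + 25 / 8) * (600 * (27 / 4 : ℝ) ^ 6 + a))) ^ 2)⁻¹ * (Real.sqrt (25 / 8) * (max 2 (16 / a))) + (Real.sqrt (25 / 8) * (max 2 (16 / a))) * (((2 / ((1 + 25 / 8) * (600 * (27 / 4 : ℝ) ^ 6 + a))) ^ 2)⁻¹ * (εN * (((2 / ((1 + 25 / 8) * (600 * (27 / 4 : ℝ) ^ 6 + a))) ^ 2)⁻¹ * (Real.sqrt (25 / 8) * (max 2 (16 / a)))) + (Real.sqrt (25 / 8) * (max 2 (16 / a)) ^ 2 * Real.sqrt (25 / 8) + Real.sqrt (25 / 8) * (max 2 (16 / a)) ^ 2 * Real.sqrt (25 / 8)) * ((18 / (2 / ((1 + 25 / 8) * (600 * (27 / 4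 : ℝ) ^ 6 + a))) ^ 2) * (24 * (max 2 (16 / a)) * Real.sqrt (25 / 8)) * (4 * (2 * (1 + 2 / (1 / (10 * Real.sqrt (max 2 (16 / a)) * Real.sqrt (27 + 2025 / 8 * a))))) ^ 3) * Real.sqrt ((2 * (1 + 2 * (2 / (1 / (10 * Real.sqrt (max 2 (16 / a)) * Real.sqrt (27 + 2025 / 8 * a))) + 3 * ((Real.sqrt (max 2 (16 / a)) * (2 + Real.sqrt (max 2 (16 / a))) * (3 * Real.sqrt 3 + 27 + 9 * Real.sqrt a * Real.sqrt (25 / 8) + 81 * a * (25 / 8))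
          * (8 * Real.sqrt (max 2 (16 / a)) + 8 * Real.sqrt (max 2 (16 / a)) ^ 2) * (10 * Real.sqrt (25 / 8)) + 9 * (max 2 (16 / a)) * Real.sqrt (25 / 8))) / (2 / ((1 + 25 / 8) * (600 * (27 / 4 : ℝ) ^ 6 + a)))))) ^ 3 * (4 * (2 * (1 + 2 * (2 / (1 / (10 * Real.sqrt (max 2 (16 / a)) * Real.sqrt (27 + 2025 / 8 * a))) + 3 * ((Real.sqrt (max 2 (16 / a)) * (2 + Real.sqrt (max 2 (16 / a))) * (3 * Real.sqrt 3 + 27 + 9 * Real.sqrt a * Real.sqrt (25 / 8) + 81 * a * (25 / 8))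
          * (8 * Real.sqrt (max 2 (16 / a)) + 8 * Real.sqrt (max 2 (16 / a)) ^ 2) * (10 * Real.sqrt (25 / 8)) + 9 * (max 2 (16 / a)) * Real.sqrt (25 / 8))) / (2 / ((1 + 25 / 8) * (600 * (27 / 4 : ℝ) ^ 6 + a)))))) ^ 3)) * Real.exp (-((min ((1 / (10 * Real.sqrt (max 2 (16 / a)) * Real.sqrt (27 + 2025 / 8 * a))) / 2) ((2 / ((1 + 25 / 8) * (600 * (27 / 4 : ℝ) ^ 6 + a))) / (3 * ((Real.sqrt (max 2 (16 / a)) * (2 + Real.sqrt (max 2 (16 / a))) * (3 * Real.sqrt 3 + 27 + 9 * Real.sqrt a * Real.sqrt (25 / 8) + 81 * a * (25 / 8))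
          * (8 * Real.sqrt (max 2 (16 / a)) + 8 * Real.sqrt (max 2 (16 / a)) ^ 2) * (10 * Real.sqrt (25 / 8)) + 9 * (max 2 (16 / a)) * Real.sqrt (25 / 8)))))) * r / 2))))) + (Real.sqrt (25 / 8) * (max 2 (16 / a))) * ((2 / ((1 + 25 / 8) * (600 * (27 / 4 : ℝ) ^ 6 + a))) ^ 2)⁻¹ * (Real.sqrt (25 / 8) * cG + cQ))
      ≤ t := by
  have hMge : (2 : ℝ) ≤ max 2 (16 / a) := le_max_left _ _
  have hμ'0 : (0 : ℝ) < (min ((1 / (10 * Real.sqrt (max 2 (16 / a)) * Real.sqrt (27 + 2025 / 8 * a))) / 2) ((2 / ((1 + 25 / 8) * (600 * (27 / 4 : ℝ) ^ 6 + a))) / (3 * ((Real.sqrt (max 2 (16 / a)) * (2 + Real.sqrt (max 2 (16 / a))) * (3 * Real.sqrt 3 + 27 + 9 * Real.sqrt a * Real.sqrt (25 / 8) + 81 * a * (25 / 8))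
          * (8 * Real.sqrt (max 2 (16 / a)) + 8 * Real.sqrt (max 2 (16 / a)) ^ 2) * (10 * Real.sqrt (25 / 8)) + 9 * (max 2 (16 / a)) * Real.sqrt (25 / 8)))))) := lt_min (by positivity) (by positivity)
  exact budget_of_quarters (Real.sqrt_pos.2 (by norm_num)) (by positivity) (by positivity) (by positivity) hμ'0 ht hcG hcQ hεN hr

end Budget

end Summit.QuantumFields.YangMills.Theorems.Prop7LocalProjectorRowCubeWindow

end
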